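import Summits.QuantumFields.YangMills.Theorems.LuscherReductionRunningReductionTraceFormulaAveraging
import Literature.Analysis.OperatorTheory.HeterogeneousCyclicPeeling
import HarnessLib

/-!
# Crux RED `RunningReduction`, line «KTR» rev 6, towards `TT.stub_traceFormula` (2/3): the physically averaged bond kernel `K_β^P` —
# bound, joint measurability, symmetry, action on physical functions; `Z_phys` as a closed `K_β^P`-chain; its `L²` operator on `physL2 ⊕ physL2ᗮ`

Fleet-service module of seat ym-infvol-p1 g3 (route `LuscherReduction`, crux RED `stmt-QuantumFields-19978`; owner ym-beyond-p1 g18 ask (δ)).  Second of three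
modules proving the body of `TT.TraceFormula`.  With `K_β^P(U,V) = physKernel β U V = (P K_β(U,·))(V)` (p507042):

* §4 `|K_β^P| ≤ M`, joint strong measurability, **symmetry `K_β^P(U,V) = K_β^P(V,U)`** (gauge∕twist invariance and symmetry of `K_β`, inversion
  invariance of Haar measure), both sections physical, **`∫ K_β^P(U,V) ψ(V) dV = ∫ K_β(U,V) ψ(V) dV` for physical `ψ`**, hence the pointwise operators
  of `K_β^P` and `K_β` have the same iterates on a physical seed (`iterate_physKernelOp_eq`);
* §5 **`physTraceSucc_eq_integral_iterate`**: peeling the closed chain of `physTraceSucc` (`m+1` bonds `K_β`, one bond `K_β^P`; Lit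
  `integral_cyclic_het_eq_foldr`) gives `Z_phys(L,β,m+2) = ∫ (κ_{K_β}^[m+1] K_β^P(·,x))(x) dx = ∫ (κ_{K_β^P}^[m+1] K_β^P(·,x))(x) dx` — the
  diagonal kernel-iterate form of Lit `hasSum_pow_integral_iterate_diag` for the kernel `K_β^P`;
* §6 the `L²` operator of `K_β^P` (Lit `exists_kernelOp`) EQUALS the transfer operator of `K_β` on the physical closed subspace `physL2 L` (dense
  core `toL2 ψ` + continuity) and VANISHES on `(physL2 L)ᗮ` (its sections are physical classes).

HONEST FRAMING: fixed-lattice functional analysis for the femto rung R2b1; no renormalisation-group content; nothing here bears on infinite volume,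
the continuum limit or the Clay gap.
References: [cite: Luscher1983, §2]; [cite: MontvayMunster1994, (3.145)]; [cite: ReedSimonIV1978, Thm. XIII.2]; [cite: SeilerLNP1982, §3].
-/

set_option autoImplicit false

noncomputable section

open MeasureTheory Filter Topology Real
open Literature.MathematicalPhysics.QuantumFieldTheory
open Literature.MathematicalPhysics.QuantumLattice
open Literature.Analysis.OperatorTheory.YMMatrixModel
open Literature.Analysis.OperatorTheory
open scoped InnerProductSpace BigOperators

namespace Summit.QuantumFields.YangMills.Theorems.FemtoTransferGap.TT

open Summit.QuantumFields.YangMills.Theorems.FemtoTransferGap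
open Summit.QuantumFields.YangMills.Theorems.FemtoTransferGap.PhysL2

variable {L : ℕ} [NeZero L]

/-! ## §4 The physically averaged bond kernel: bound, measurability, symmetry, action on physical functions -/

/-- The transfer kernel's absolute bound (it is positive): `|K_β(U,V)| ≤ M`. [folklore] -/
theorem exists_abs_transferKernel_le (β : ℝ) :
    ∃ M : ℝ, 0 ≤ M ∧ ∀ U V : GaugeConfig 3 L SU2, |transferKernel su2Rep β U V| ≤ M := by
  obtain ⟨M, hM0, hM⟩ := exists_norm_transferKernel_le (L := L) β
  exact ⟨M, hM0, fun U V => by rw [← Real.norm_eq_abs]; exact hM U V⟩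

/-- `physKernel` unfolded. [folklore] -/
theorem physKernel_apply (β : ℝ) (U V : GaugeConfig 3 L SU2) :
    physKernel β U V = (1 / 8 : ℝ) * ∑ z : Fin 3 → Bool, ∫ g, transferKernel su2Rep β U (gaugeTransform g (twist3 z V)) ∂gaugeMeasure L := rfl

/-- The section `V ↦ K_β(U, V)` is measurable. [folklore] -/
theorem measurable_transferKernel_right (β : ℝ) (U : GaugeConfig 3 L SU2) :
    Measurable fun V : GaugeConfig 3 L SU2 => transferKernel su2Rep β U V :=
  (continuous_transferKernel_right β U).measurable

/-- **Bound** `|K_β^P(U,V)| ≤ M`. [folklore] -/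
theorem abs_physKernel_le {β M : ℝ} (hM : ∀ U V : GaugeConfig 3 L SU2, |transferKernel su2Rep β U V| ≤ M) (U V : GaugeConfig 3 L SU2) :
    |physKernel β U V| ≤ M :=
  abs_physAvg_le (f := transferKernel su2Rep β U) (hM U) V

/-- **Joint measurability** of `K_β^P`. [folklore] -/
theorem stronglyMeasurable_physKernel (β : ℝ) :
    StronglyMeasurable (Function.uncurry fun U V : GaugeConfig 3 L SU2 => physKernel β U V) := by
  haveI := isProbabilityMeasure_gaugeMeasure (L := L)
  have hK := (stronglyMeasurable_transferKernel (L := L) β).measurable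
  have hsum : ∀ z : Fin 3 → Bool, Measurable fun p : GaugeConfig 3 L SU2 × GaugeConfig 3 L SU2 =>
      ∫ g, transferKernel su2Rep β p.1 (gaugeTransform g (twist3 z p.2)) ∂gaugeMeasure L := by
    intro z
    have hA : Measurable fun q : (GaugeConfig 3 L SU2 × GaugeConfig 3 L SU2) × (Site 3 L → SU2) => (q.2, q.1.2) :=
      measurable_snd.prodMk (measurable_snd.comp measurable_fst)
    have hB := (measurable_act_uncurry (L := L) z).comp hA
    have hC := (measurable_fst.comp (measurable_fst (α := GaugeConfig 3 L SU2 × GaugeConfig 3 L SU2)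
      (β := Site 3 L → SU2))).prodMk hB
    have h2 := hK.comp hC
    have h3 : StronglyMeasurable (Function.uncurry fun (p : GaugeConfig 3 L SU2 × GaugeConfig 3 L SU2) (g : Site 3 L → SU2) =>
        transferKernel su2Rep β p.1 (gaugeTransform g (twist3 z p.2))) := h2.stronglyMeasurable
    have h4 := StronglyMeasurable.integral_prod_right (ν := gaugeMeasure L) h3
    exact h4.measurable
  have h : Measurable fun p : GaugeConfig 3 L SU2 × GaugeConfig 3 L SU2 => physKernel β p.1 p.2 := by
    simp only [physKernel_apply]
    exact Measurable.const_mul (Finset.measurable_sum _ fun z _ => hsum z) _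
  exact h.stronglyMeasurable

/-- **Symmetry** `K_β^P(U,V) = K_β^P(V,U)` (gauge∕twist invariance and symmetry of `K_β`, inversion invariance of Haar measure).
[cite: Luscher1983, §2] -/
theorem physKernel_symm (β : ℝ) (U V : GaugeConfig 3 L SU2) : physKernel β U V = physKernel β V U := by
  haveI := isInvInvariant_gaugeMeasure (L := L)
  rw [physKernel_apply, physKernel_apply]
  refine congrArg (fun x : ℝ => (1 / 8 : ℝ) * x) (Finset.sum_congr rfl fun z _ => ?_)
  have h1 : ∀ g : Site 3 L → SU2, transferKernel su2Rep β V (gaugeTransform g (twist3 z U)) =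
      transferKernel su2Rep β U (gaugeTransform g⁻¹ (twist3 z V)) := fun g => by
    rw [transferKernel_su2Rep_symm, transferKernel_act_left]
  simp_rw [h1]
  exact (integral_inv_eq_self (fun g : Site 3 L → SU2 => transferKernel su2Rep β U (gaugeTransform g (twist3 z V))) (gaugeMeasure L)).symm

/-- The right section `V ↦ K_β^P(U, V)` is a physical zero-flux test function. [cite: Luscher1983, §2] -/
theorem isPhys_physKernel_right {β M : ℝ} (hM : ∀ U V : GaugeConfig 3 L SU2, |transferKernel su2Rep β U V| ≤ M) (U : GaugeConfig 3 L SU2) :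
    IsPhys fun V : GaugeConfig 3 L SU2 => physKernel β U V :=
  isPhys_physAvg (measurable_transferKernel_right β U) (hM U)

/-- The left section `U ↦ K_β^P(U, V)` is a physical zero-flux test function (by symmetry). [cite: Luscher1983, §2] -/
theorem isPhys_physKernel_left {β M : ℝ} (hM : ∀ U V : GaugeConfig 3 L SU2, |transferKernel su2Rep β U V| ≤ M) (V : GaugeConfig 3 L SU2) :
    IsPhys fun U : GaugeConfig 3 L SU2 => physKernel β U V := by
  have h : (fun U : GaugeConfig 3 L SU2 => physKernel β U V) = fun U => physKernel β V U := funext fun U => physKernel_symm β U V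
  rw [h]
  exact isPhys_physKernel_right hM V

/-- **`K_β^P` acts as `K_β` on physical test functions**: `∫ K_β^P(U,V) ψ(V) dV = ∫ K_β(U,V) ψ(V) dV`. [cite: Luscher1983, §2] -/
theorem integral_physKernel_mul_of_isPhys {β M : ℝ} (hM : ∀ U V : GaugeConfig 3 L SU2, |transferKernel su2Rep β U V| ≤ M)
    {ψ : GaugeConfig 3 L SU2 → ℝ} (hψ : IsPhys ψ) (U : GaugeConfig 3 L SU2) :
    ∫ V, physKernel β U V * ψ V ∂configMeasure SU2 L = ∫ V, transferKernel su2Rep β U V * ψ V ∂configMeasure SU2 L :=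
  integral_physAvg_mul_of_isPhys (measurable_transferKernel_right β U) (hM U) hψ

/-- The pointwise transfer operator of `K_β^P` agrees with that of `K_β` on physical test functions. [cite: Luscher1983, §2] -/
theorem physKernelOp_eq_transferApply {β M : ℝ} (hM : ∀ U V : GaugeConfig 3 L SU2, |transferKernel su2Rep β U V| ≤ M)
    {ψ : GaugeConfig 3 L SU2 → ℝ} (hψ : IsPhys ψ) :
    (fun U => ∫ V, physKernel β U V * ψ V ∂configMeasure SU2 L) = transferApply β ψ := by
  funext U
  rw [integral_physKernel_mul_of_isPhys hM hψ, transferApply_apply]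

/-- **Iterates**: on a physical seed the iterated pointwise operators of `K_β^P` and of `K_β` coincide, and stay physical.
[cite: Luscher1983, §2] -/
theorem iterate_physKernelOp_eq {β M : ℝ} (hM : ∀ U V : GaugeConfig 3 L SU2, |transferKernel su2Rep β U V| ≤ M)
    {ψ : GaugeConfig 3 L SU2 → ℝ} (hψ : IsPhys ψ) (m : ℕ) :
    (fun f : GaugeConfig 3 L SU2 → ℝ => fun U => ∫ V, physKernel β U V * f V ∂configMeasure SU2 L)^[m] ψ =
      (fun f : GaugeConfig 3 L SU2 → ℝ => fun U => ∫ V, transferKernel su2Rep β U V * f V ∂configMeasure SU2 L)^[m] ψ ∧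
    IsPhys ((fun f : GaugeConfig 3 L SU2 → ℝ => fun U => ∫ V, transferKernel su2Rep β U V * f V ∂configMeasure SU2 L)^[m] ψ) := by
  induction m with
  | zero => exact ⟨rfl, hψ⟩
  | succ m ih =>
    obtain ⟨ih1, ih2⟩ := ih
    have hK : (fun f : GaugeConfig 3 L SU2 → ℝ => fun U => ∫ V, transferKernel su2Rep β U V * f V ∂configMeasure SU2 L)^[m + 1] ψ =
        transferApply β ((fun f : GaugeConfig 3 L SU2 → ℝ => fun U => ∫ V, transferKernel su2Rep β U V * f V ∂configMeasure SU2 L)^[m] ψ) := by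
      rw [Function.iterate_succ_apply']
      funext U
      rw [transferApply_apply]
    refine ⟨?_, ?_⟩
    · rw [Function.iterate_succ_apply', ih1, physKernelOp_eq_transferApply hM ih2, hK]
    · rw [hK]; exact isPhys_transferApply β ih2


/-! ## §5 The zero-flux trace as a diagonal kernel iterate of `K_β^P` -/

omit [NeZero L] in
/-- Relabelling a cyclic kernel product along `Fin a = Fin b`. [folklore] -/
theorem integral_cyclic_congr_fin {a b : ℕ} [NeZero a] [NeZero b] (h : a = b)
    (κ : ℕ → GaugeConfig 3 L SU2 → GaugeConfig 3 L SU2 → ℝ) (μ : Measure (GaugeConfig 3 L SU2)) :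
    ∫ V : Fin a → GaugeConfig 3 L SU2, ∏ s : Fin a, κ s (V s) (V (s + 1)) ∂(Measure.pi fun _ => μ) =
      ∫ V : Fin b → GaugeConfig 3 L SU2, ∏ s : Fin b, κ s (V s) (V (s + 1)) ∂(Measure.pi fun _ => μ) := by
  subst h; rfl

/-- The integrand of `physTraceSucc L β (m+1)` as a cyclic product of `m+1` bonds `K_β` and one bond `K_β^P`. [folklore] -/
theorem physTraceSucc_integrand_eq (β : ℝ) (m : ℕ) (V : Fin (m + 2) → GaugeConfig 3 L SU2) :
    (∏ i : Fin (m + 1), transferKernel su2Rep β (V i.castSucc) (V i.succ)) * physKernel β (V (Fin.last (m + 1))) (V 0) =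
      ∏ t : Fin (m + 2), (fun s : ℕ => if s = m + 1 then physKernel (L := L) β else transferKernel su2Rep β) t (V t) (V (t + 1)) := by
  symm
  rw [Fin.prod_univ_castSucc]
  congr 1
  · refine Finset.prod_congr rfl fun i _ => ?_
    have hi : ((Fin.castSucc i : Fin (m + 2)) : ℕ) ≠ m + 1 := by
      rw [Fin.val_castSucc]; exact ne_of_lt i.isLt
    simp only [hi, if_false, Fin.coeSucc_eq_succ]
  · simp only [Fin.val_last, if_true, Fin.last_add_one]

/-- **`Z_phys(L, β, m+2)` is the diagonal integral of the `(m+1)`-st `K_β`-iterate of the section `K_β^P(·, x)`** (peeling the cycle,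
Lit `integral_cyclic_het_eq_foldr`). [cite: MontvayMunster1994, (3.145)] -/
theorem physTraceSucc_eq_integral_iterate_K {β M : ℝ} (hM : ∀ U V : GaugeConfig 3 L SU2, |transferKernel su2Rep β U V| ≤ M) (m : ℕ) :
    physTraceSucc L β (m + 1) =
      ∫ x, ((fun f : GaugeConfig 3 L SU2 → ℝ => fun w => ∫ z, transferKernel su2Rep β w z * f z ∂configMeasure SU2 L)^[m + 1]
        (fun z => physKernel β z x)) x ∂configMeasure SU2 L := by
  set κ : ℕ → GaugeConfig 3 L SU2 → GaugeConfig 3 L SU2 → ℝ := fun s => if s = m + 1 then physKernel (L := L) β else transferKernel su2Rep β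
    with hκdef
  have hκ : ∀ t, Measurable (Function.uncurry (κ t)) := fun t => by
    by_cases ht : t = m + 1
    · simp only [hκdef, ht, if_true]; exact (stronglyMeasurable_physKernel (L := L) β).measurable
    · simp only [hκdef, ht, if_false]; exact (stronglyMeasurable_transferKernel (L := L) β).measurable
  have hC : ∀ t x y, ‖κ t x y‖ ≤ M := fun t x y => by
    rw [Real.norm_eq_abs]
    by_cases ht : t = m + 1
    · simp only [hκdef, ht, if_true]; exact abs_physKernel_le hM x y
    · simp only [hκdef, ht, if_false]; exact hM x y
  -- the cyclic integral, relabelled to `Fin (1 + m + 1)`, then peeled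
  have h1 : physTraceSucc L β (m + 1) =
      ∫ V : Fin (m + 2) → GaugeConfig 3 L SU2, ∏ t : Fin (m + 2), κ t (V t) (V (t + 1)) ∂(Measure.pi fun _ => configMeasure SU2 L) := by
    unfold physTraceSucc
    refine integral_congr_ae (ae_of_all _ fun V => ?_)
    exact physTraceSucc_integrand_eq β m V
  have h2 := integral_cyclic_congr_fin (L := L) (show m + 2 = 1 + m + 1 by omega) κ (configMeasure SU2 L)
  have h3 := integral_cyclic_het_eq_foldr (ρ := configMeasure SU2 L) hκ hC m
  rw [h1, h2, h3]
  refine integral_congr_ae (ae_of_all _ fun x => ?_)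
  dsimp only
  have hlast : κ (m + 1) = physKernel (L := L) β := by simp [hκdef]
  have h4 := foldr_op_eq_iterate_of_eq (ρ := configMeasure SU2 L) κ (transferKernel su2Rep β) (m + 1) 0
    (fun i hi => by simp [hκdef, Nat.ne_of_lt hi]) (fun w => κ (m + 1) w x)
  simp only [Nat.add_zero] at h4
  rw [h4, hlast]

/-- **`Z_phys(L, β, m+2)` is the diagonal integral of the `(m+1)`-st `K_β^P`-iterate of the section `K_β^P(·, x)`** — the closed
`K_β^P`-chain: on the physical section the `K_β`- and `K_β^P`-iterates coincide (`iterate_physKernelOp_eq`). [cite: MontvayMunster1994, (3.145)] -/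
theorem physTraceSucc_eq_integral_iterate {β M : ℝ} (hM : ∀ U V : GaugeConfig 3 L SU2, |transferKernel su2Rep β U V| ≤ M) (m : ℕ) :
    physTraceSucc L β (m + 1) =
      ∫ x, ((fun f : GaugeConfig 3 L SU2 → ℝ => fun w => ∫ z, physKernel β w z * f z ∂configMeasure SU2 L)^[m + 1]
        (fun z => physKernel β z x)) x ∂configMeasure SU2 L := by
  rw [physTraceSucc_eq_integral_iterate_K hM m]
  refine integral_congr_ae (ae_of_all _ fun x => ?_)
  dsimp only
  rw [(iterate_physKernelOp_eq hM (isPhys_physKernel_left hM x) (m + 1)).1]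


/-! ## §6 The `L²` operator of `K_β^P`: it is `K_β` on the physical closed subspace and `0` on its orthogonal complement -/

/-- The `L²` operator of `K_β^P` agrees with that of `K_β` on the physical closed subspace (core + closure). [cite: ReedSimonIV1978, Thm. XIII.2] -/
theorem kernelOpP_apply_of_mem_physL2 {β M : ℝ} (hM : ∀ U V : GaugeConfig 3 L SU2, |transferKernel su2Rep β U V| ≤ M)
    {A : Lp ℝ 2 (configMeasure SU2 L) →L[ℝ] Lp ℝ 2 (configMeasure SU2 L)}
    (hA : ∀ v : Lp ℝ 2 (configMeasure SU2 L),
      (A v : GaugeConfig 3 L SU2 → ℝ) =ᵐ[configMeasure SU2 L] fun U => ∫ V, transferKernel su2Rep β U V * v V ∂configMeasure SU2 L)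
    {AP : Lp ℝ 2 (configMeasure SU2 L) →L[ℝ] Lp ℝ 2 (configMeasure SU2 L)}
    (hAP : ∀ v : Lp ℝ 2 (configMeasure SU2 L),
      (AP v : GaugeConfig 3 L SU2 → ℝ) =ᵐ[configMeasure SU2 L] fun U => ∫ V, physKernel β U V * v V ∂configMeasure SU2 L)
    {v : Lp ℝ 2 (configMeasure SU2 L)} (hv : v ∈ physL2 L) : AP v = A v := by
  have hS : IsClosed {w : Lp ℝ 2 (configMeasure SU2 L) | AP w = A w} := isClosed_eq AP.continuous A.continuous
  refine physL2_induction hS (fun ψ => ?_) hv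
  show AP (toL2 ψ) = A (toL2 ψ)
  apply Lp.ext
  filter_upwards [hAP (toL2 ψ), hA (toL2 ψ)] with U h1 h2
  rw [h1, h2]
  have e1 : ∫ V, physKernel β U V * (toL2 ψ : GaugeConfig 3 L SU2 → ℝ) V ∂configMeasure SU2 L =
      ∫ V, physKernel β U V * (ψ : GaugeConfig 3 L SU2 → ℝ) V ∂configMeasure SU2 L :=
    integral_congr_ae (by filter_upwards [coeFn_toL2 ψ] with V hV; rw [hV])
  have e2 : ∫ V, transferKernel su2Rep β U V * (toL2 ψ : GaugeConfig 3 L SU2 → ℝ) V ∂configMeasure SU2 L =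
      ∫ V, transferKernel su2Rep β U V * (ψ : GaugeConfig 3 L SU2 → ℝ) V ∂configMeasure SU2 L :=
    integral_congr_ae (by filter_upwards [coeFn_toL2 ψ] with V hV; rw [hV])
  rw [e1, e2, integral_physKernel_mul_of_isPhys hM (isPhys_coe ψ) U]

/-- The `L²` operator of `K_β^P` vanishes on the orthogonal complement of the physical closed subspace (its sections are physical).
[cite: ReedSimonIV1978, Thm. XIII.2] -/
theorem kernelOpP_apply_of_mem_orthogonal {β M : ℝ} (hM : ∀ U V : GaugeConfig 3 L SU2, |transferKernel su2Rep β U V| ≤ M)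
    {AP : Lp ℝ 2 (configMeasure SU2 L) →L[ℝ] Lp ℝ 2 (configMeasure SU2 L)}
    (hAP : ∀ v : Lp ℝ 2 (configMeasure SU2 L),
      (AP v : GaugeConfig 3 L SU2 → ℝ) =ᵐ[configMeasure SU2 L] fun U => ∫ V, physKernel β U V * v V ∂configMeasure SU2 L)
    {w : Lp ℝ 2 (configMeasure SU2 L)} (hw : w ∈ (physL2 L)ᗮ) : AP w = 0 := by
  apply Lp.ext
  filter_upwards [hAP w, Lp.coeFn_zero ℝ 2 (configMeasure SU2 L)] with U h1 h2
  rw [h1, h2, Pi.zero_apply]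
  set ψ : physSubmodule L := ⟨fun V => physKernel β U V, isPhys_physKernel_right hM U⟩ with hψ
  have h3 := inner_toL2_left ψ w
  have h4 : ⟪toL2 ψ, w⟫_ℝ = 0 := Submodule.inner_right_of_mem_orthogonal (toL2_mem_physL2 ψ) hw
  rw [h4] at h3
  exact h3.symm

end Summit.QuantumFields.YangMills.Theorems.FemtoTransferGap.TT

end
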